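import Summits.CriticalPhenomena.PercolationContinuityZ3.Theorems.PercNearOneGluingAdditiveGluingAL5TwoRelaysTools
import HarnessLib

/-! # Crux `PercNearOneGluing.AdditiveGluing` (stmt-CriticalPhenomena-4576) — AL5 with TWO relay neighbours, in general

Support file (`--supports stmt-CriticalPhenomena-4576`; task png-dp-al5); no definitions, no named facts.  Notation of
`…AL5Layers.lean`: `μ_w = prodBernoulli w` on the bond configurations of the weighted complete graph `Fin n`, target `b`,
`τ_w(v) = μ_w(v ↔ b)`, bystander `x`, glued block `w^S := fun e => if e ∈ S.image (s(x,·)) then 1 else w e`,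
relay neighbours `T`, `R = {ω | ∃ a ∈ T, s(x,a) ∈ ω}`; AL5 is `μ_{w^S}(R ∩ {d ↔ b}) ≤ μ_{w^S}(R ∩ {x ↔ b})` under
`τ_w(d) ≤ τ_w(a)` for `a ∈ T` (hypothesis in the UN-glued weighting `w`).

**Theorem (`al5_twoRelays_general`).**  AL5 holds for `T = {a₁, a₂}` and EVERY block `S` (`x ∉ S`, `a₁, a₂ ∉ S`), with NO
assumption on the other pairs at `x`: the block star `x–S` may carry arbitrary ("real") weights in `w`, and `x` may have
further neighbours of positive weight (other blocks, free vertices, `d`, `b`).  This removes both restrictions of the landed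
`al5_twoRelays` (`…AL5TwoRelays.lean`: `x` pendant on `{a₁, a₂}`, virtual block star).

**Proof (interpolation of the second relay edge).**  Write `e_i = s(x,a_i)`, `p_i = w(e_i)`, and for `σ, τ ∈ {0,1}` let
`Ḡ_{στ} = τ_{w^{στ}}(x) − τ_{w^{στ}}(d)` for the pinned weighting `w^{στ} = w[e₁ ↦ σ, e₂ ↦ τ]` (block NOT glued) and
`G_{στ}` the same quantity for `(w^S)^{στ}` (block glued).  By the two-edge pattern expansion
(`al5_twoEdge_real_inter_R`) the AL5 margin is `p₁p₂G₁₁ + p₁(1−p₂)G₁₀ + (1−p₁)p₂G₀₁`, and the margin of the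
multi-edge Lemma 3 in `w` (`multiEdge_lemma3`, Kozma–Nitzan Lemma 3(i) for the union of the two relay layers) is
`(m) p₁p₂Ḡ₁₁ + p₁(1−p₂)Ḡ₁₀ + (1−p₁)p₂Ḡ₀₁ ≥ 0`.  Kozma–Nitzan's Lemma 5 (gluing `e₁` at `a₁`, `al5_glue_edge`) gives
`(b1) p₂Ḡ₁₁ + (1−p₂)Ḡ₁₀ ≥ 0`, symmetrically `(b2)`, and `(b11) Ḡ₁₁ ≥ 0`.  The new ingredient is the TRANSFER
`(T1)`: for every `t ∈ [0,1]`, `tḠ₁₁ + (1−t)Ḡ₁₀ ≥ 0 ⟹ tG₁₁ + (1−t)G₁₀ ≥ 0` — the premise says precisely that the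
hypothesis `τ(d) ≤ τ(a₁)` holds for the RE-WEIGHTING `w[e₁ ↦ 1, e₂ ↦ t]` (it is affine in the weight of `e₂`), and then
the single-layer AL5 (`al5_layer`, iterated Lemma 5: glue the block star at `x`) yields the glued version; `(T2)` likewise.
Algebra (`al5_twoRelays_arith`): if `Ḡ₁₀ ≥ 0` then `G₁₀ ≥ 0` (`T1`, `t = 0`) and `p₁G₁₁ + (1−p₁)G₀₁ ≥ 0` (`T2`, `t = p₁`,
premise `(b2)`), so the margin `p₁(1−p₂)G₁₀ + p₂[p₁G₁₁ + (1−p₁)G₀₁]` is `≥ 0`; symmetrically if `Ḡ₀₁ ≥ 0`; if both are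
negative, `T1` at `t* = Ḡ₁₀⁻/(Ḡ₁₀⁻ + Ḡ₁₁)` (premise `= 0`) gives `Ḡ₁₁G₁₀ ≥ Ḡ₁₀G₁₁`, likewise `Ḡ₁₁G₀₁ ≥ Ḡ₀₁G₁₁`, whence
`Ḡ₁₁ · margin ≥ G₁₁ · (m) ≥ 0` (`G₁₁ ≥ 0` by `T1` at `t = 1`; if `Ḡ₁₁ = 0`, `(m)` forces `p₁(1−p₂) = (1−p₁)p₂ = 0`).
Numerically (task lab, exact enumeration): every step verified on 10 331 instances, `n = 7`, general neighbourhoods.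
[cite: KozmaNitzan2024, Lemma 3(i) (pp. 6–7), Lemma 5 (p. 13)]
-/

namespace Summit.CriticalPhenomena.PercolationContinuityZ3.Theorems

open MeasureTheory Set
open Literature.Probability.LatticeModels (prodBernoulli)
open Literature.Probability.Percolation (BondConfig openConn openConnIn openGraph openEdgeCluster pinW localCylinder)

noncomputable section
open Classical

section AL5TwoRelaysGeneral

open Filter Topology Literature.Probability.LatticeModels Literature.Probability.Percolation

variable {n : ℕ}

/-- The real arithmetic of the interpolation argument (see the module docstring): from the multi-edge Lemma 3 margin
`(m)`, the glued-edge hypotheses `(b1)`, `(b2)`, `(b11)` and the two transfers `(T1)`, `(T2)` (UN-glued nonnegativity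
along the segment `t ↦ tḠ₁₁ + (1−t)Ḡ₁₀` implies glued nonnegativity), the glued margin is nonnegative. [folklore] -/
theorem al5_twoRelays_arith {p₁ p₂ gb11 gb10 gb01 g11 g10 g01 : ℝ} (hp1 : 0 ≤ p₁) (hp1' : p₁ ≤ 1)
    (hp2 : 0 ≤ p₂) (hp2' : p₂ ≤ 1)
    (hm : 0 ≤ p₁ * p₂ * gb11 + p₁ * (1 - p₂) * gb10 + (1 - p₁) * p₂ * gb01)
    (hb1 : 0 ≤ p₂ * gb11 + (1 - p₂) * gb10) (hb2 : 0 ≤ p₁ * gb11 + (1 - p₁) * gb01) (hb11 : 0 ≤ gb11)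
    (T1 : ∀ t : ℝ, 0 ≤ t → t ≤ 1 → 0 ≤ t * gb11 + (1 - t) * gb10 → 0 ≤ t * g11 + (1 - t) * g10)
    (T2 : ∀ t : ℝ, 0 ≤ t → t ≤ 1 → 0 ≤ t * gb11 + (1 - t) * gb01 → 0 ≤ t * g11 + (1 - t) * g01) :
    0 ≤ p₁ * p₂ * g11 + p₁ * (1 - p₂) * g10 + (1 - p₁) * p₂ * g01 := by
  have h1p1 : 0 ≤ 1 - p₁ := sub_nonneg.2 hp1'
  have h1p2 : 0 ≤ 1 - p₂ := sub_nonneg.2 hp2'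
  have g11nn : 0 ≤ g11 := by
    have h := T1 1 zero_le_one le_rfl (by rw [sub_self, zero_mul, add_zero, one_mul]; exact hb11)
    rwa [sub_self, zero_mul, add_zero, one_mul] at h
  -- homogeneous form of the transfers
  have T1h : ∀ α β : ℝ, 0 ≤ α → 0 ≤ β → 0 < α + β → 0 ≤ α * gb11 + β * gb10 → 0 ≤ α * g11 + β * g10 := by
    intro α β hα hβ hαβ h
    have ht0 : 0 ≤ α / (α + β) := div_nonneg hα hαβ.le
    have ht1 : α / (α + β) ≤ 1 := (div_le_one hαβ).2 (by linarith)
    have hpre : 0 ≤ α / (α + β) * gb11 + (1 - α / (α + β)) * gb10 := by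
      have heq : α / (α + β) * gb11 + (1 - α / (α + β)) * gb10 = (α * gb11 + β * gb10) / (α + β) := by
        field_simp
        ring
      rw [heq]
      exact div_nonneg h hαβ.le
    have key := mul_nonneg hαβ.le (T1 _ ht0 ht1 hpre)
    have heq : (α + β) * (α / (α + β) * g11 + (1 - α / (α + β)) * g10) = α * g11 + β * g10 := by
      field_simp
      ring
    rwa [heq] at key
  have T2h : ∀ α β : ℝ, 0 ≤ α → 0 ≤ β → 0 < α + β → 0 ≤ α * gb11 + β * gb01 → 0 ≤ α * g11 + β * g01 := by
    intro α β hα hβ hαβ h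
    have ht0 : 0 ≤ α / (α + β) := div_nonneg hα hαβ.le
    have ht1 : α / (α + β) ≤ 1 := (div_le_one hαβ).2 (by linarith)
    have hpre : 0 ≤ α / (α + β) * gb11 + (1 - α / (α + β)) * gb01 := by
      have heq : α / (α + β) * gb11 + (1 - α / (α + β)) * gb01 = (α * gb11 + β * gb01) / (α + β) := by
        field_simp
        ring
      rw [heq]
      exact div_nonneg h hαβ.le
    have key := mul_nonneg hαβ.le (T2 _ ht0 ht1 hpre)
    have heq : (α + β) * (α / (α + β) * g11 + (1 - α / (α + β)) * g01) = α * g11 + β * g01 := by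
      field_simp
      ring
    rwa [heq] at key
  by_cases h10 : 0 ≤ gb10
  · -- `G₁₀ ≥ 0` and `p₁ G₁₁ + (1 - p₁) G₀₁ ≥ 0`
    have g10nn : 0 ≤ g10 := by
      have h := T1 0 le_rfl zero_le_one (by rw [zero_mul, zero_add, sub_zero, one_mul]; exact h10)
      rwa [zero_mul, zero_add, sub_zero, one_mul] at h
    have A2 : 0 ≤ p₁ * g11 + (1 - p₁) * g01 := T2 p₁ hp1 hp1' hb2
    nlinarith [mul_nonneg (mul_nonneg hp1 h1p2) g10nn, mul_nonneg hp2 A2]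
  by_cases h01 : 0 ≤ gb01
  · have g01nn : 0 ≤ g01 := by
      have h := T2 0 le_rfl zero_le_one (by rw [zero_mul, zero_add, sub_zero, one_mul]; exact h01)
      rwa [zero_mul, zero_add, sub_zero, one_mul] at h
    have A1 : 0 ≤ p₂ * g11 + (1 - p₂) * g10 := T1 p₂ hp2 hp2' hb1
    nlinarith [mul_nonneg (mul_nonneg h1p1 hp2) g01nn, mul_nonneg hp1 A1]
  -- both `Ḡ₁₀ < 0` and `Ḡ₀₁ < 0`
  push Not at h10 h01
  have c1nn : 0 ≤ p₁ * (1 - p₂) := mul_nonneg hp1 h1p2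
  have c2nn : 0 ≤ (1 - p₁) * p₂ := mul_nonneg h1p1 hp2
  rcases hb11.eq_or_lt with hz | hpos
  · -- `Ḡ₁₁ = 0`: `(m)` forces both mixed coefficients to vanish
    rw [← hz, mul_zero, zero_add] at hm
    have e1 : p₁ * (1 - p₂) * gb10 ≤ 0 := mul_nonpos_of_nonneg_of_nonpos c1nn h10.le
    have e2 : (1 - p₁) * p₂ * gb01 ≤ 0 := mul_nonpos_of_nonneg_of_nonpos c2nn h01.le
    have z1 : p₁ * (1 - p₂) * gb10 = 0 := le_antisymm e1 (by linarith)
    have z2 : (1 - p₁) * p₂ * gb01 = 0 := le_antisymm e2 (by linarith)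
    have c1z : p₁ * (1 - p₂) = 0 := by
      rcases mul_eq_zero.1 z1 with h | h
      · exact h
      · exact absurd h (ne_of_lt h10)
    have c2z : (1 - p₁) * p₂ = 0 := by
      rcases mul_eq_zero.1 z2 with h | h
      · exact h
      · exact absurd h (ne_of_lt h01)
    rw [c1z, c2z, zero_mul, zero_mul, add_zero, add_zero]
    exact mul_nonneg (mul_nonneg hp1 hp2) g11nn
  · -- `Ḡ₁₁ > 0`: transfers at the zeros of the un-glued segments
    have K1 : 0 ≤ -gb10 * g11 + gb11 * g10 :=
      T1h (-gb10) gb11 (by linarith) hb11 (by linarith) (le_of_eq (by ring))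
    have K2 : 0 ≤ -gb01 * g11 + gb11 * g01 :=
      T2h (-gb01) gb11 (by linarith) hb11 (by linarith) (le_of_eq (by ring))
    have key : gb11 * 0 ≤ gb11 * (p₁ * p₂ * g11 + p₁ * (1 - p₂) * g10 + (1 - p₁) * p₂ * g01) := by
      rw [mul_zero]
      nlinarith [mul_nonneg c1nn K1, mul_nonneg c2nn K2, mul_nonneg g11nn hm]
    exact le_of_mul_le_mul_left key hpos

/-- **AL5 for every block with two relay neighbours, general neighbourhood** (see the module docstring).  Hypotheses:
`x ∉ S`, `a₁ ≠ a₂`, `a_i ≠ x`, `a_i ∉ S`, and `τ_w(d) ≤ τ_w(a_i)` (`i = 1,2`) in the UN-glued weighting `w` (no condition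
on the other pairs at `x`).  Conclusion: with `w^S` the glued block star at `x` and `R = {some edge s(x,a), a ∈ {a₁,a₂}, open}`,
`μ_{w^S}(R ∩ {d ↔ b}) ≤ μ_{w^S}(R ∩ {x ↔ b})`.
[cite: KozmaNitzan2024, Lemma 3(i) (pp. 6–7), Lemma 5 (p. 13)] -/
theorem al5_twoRelays_general (w : Sym2 (Fin n) → unitInterval) (S : Finset (Fin n)) (x d b a₁ a₂ : Fin n)
    (hS : ∀ y ∈ S, y ≠ x) (ha₁x : a₁ ≠ x) (ha₂x : a₂ ≠ x) (h₁₂ : a₁ ≠ a₂) (ha₁S : a₁ ∉ S) (ha₂S : a₂ ∉ S)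
    (hle₁ : (prodBernoulli w).real (openConn d b) ≤ (prodBernoulli w).real (openConn a₁ b))
    (hle₂ : (prodBernoulli w).real (openConn d b) ≤ (prodBernoulli w).real (openConn a₂ b)) :
    (prodBernoulli (fun e : Sym2 (Fin n) => if e ∈ S.image (fun y => s(x, y)) then 1 else w e)).real
        ({ω : Set (Sym2 (Fin n)) | ∃ a ∈ ({a₁, a₂} : Finset (Fin n)), s(x, a) ∈ ω} ∩ openConn d b) ≤
      (prodBernoulli (fun e : Sym2 (Fin n) => if e ∈ S.image (fun y => s(x, y)) then 1 else w e)).real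
        ({ω : Set (Sym2 (Fin n)) | ∃ a ∈ ({a₁, a₂} : Finset (Fin n)), s(x, a) ∈ ω} ∩ openConn x b) := by
  have hne : s(x, a₁) ≠ s(x, a₂) := by
    intro h
    rcases Sym2.eq_iff.1 h with ⟨-, h2⟩ | ⟨h1, -⟩
    · exact h₁₂ h2
    · exact ha₂x h1.symm
  have himg : ∀ a : Fin n, a ∉ S → s(x, a) ∉ S.image (fun y => s(x, y)) := by
    intro a haS hmem
    obtain ⟨y, hyS, hy⟩ := Finset.mem_image.1 hmem
    rcases Sym2.eq_iff.1 hy with ⟨-, h2⟩ | ⟨-, h2⟩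
    · exact haS (h2 ▸ hyS)
    · exact hS y hyS h2
  -- the glued weighting
  set gS : Sym2 (Fin n) → unitInterval := fun e => if e ∈ S.image (fun y => s(x, y)) then 1 else w e with hgS
  have hgS1 : gS s(x, a₁) = w s(x, a₁) := by simp only [hgS, himg a₁ ha₁S, if_false]
  have hgS2 : gS s(x, a₂) = w s(x, a₂) := by simp only [hgS, himg a₂ ha₂S, if_false]
  -- pinned weightings, un-glued (`w^{στ}`) and glued (`g^{στ}`)
  set w11 : Sym2 (Fin n) → unitInterval := fun e => if e = s(x, a₁) then 1 else if e = s(x, a₂) then 1 else w e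
    with hw11
  set w10 : Sym2 (Fin n) → unitInterval := fun e => if e = s(x, a₁) then 1 else if e = s(x, a₂) then 0 else w e
    with hw10
  set w01 : Sym2 (Fin n) → unitInterval := fun e => if e = s(x, a₁) then 0 else if e = s(x, a₂) then 1 else w e
    with hw01
  set g11 : Sym2 (Fin n) → unitInterval := fun e => if e = s(x, a₁) then 1 else if e = s(x, a₂) then 1 else gS e
    with hg11
  set g10 : Sym2 (Fin n) → unitInterval := fun e => if e = s(x, a₁) then 1 else if e = s(x, a₂) then 0 else gS e
    with hg10
  set g01 : Sym2 (Fin n) → unitInterval := fun e => if e = s(x, a₁) then 0 else if e = s(x, a₂) then 1 else gS e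
    with hg01
  -- generic pinning lemma: pinning both relay edges forgets their weights
  have hpin : ∀ (g g' : Sym2 (Fin n) → unitInterval), (∀ e, e ≠ s(x, a₁) → e ≠ s(x, a₂) → g e = g' e) →
      ∀ σ τ : unitInterval, (fun e => if e = s(x, a₁) then σ else if e = s(x, a₂) then τ else g e) =
        fun e => if e = s(x, a₁) then σ else if e = s(x, a₂) then τ else g' e := by
    intro g g' hg σ τ
    funext e
    by_cases h1 : e = s(x, a₁)
    · simp only [h1, if_true]
    · by_cases h2 : e = s(x, a₂)
      · simp only [h2, hne.symm, if_false, if_true]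
      · simp only [h1, h2, if_false, hg e h1 h2]
  -- (m) the multi-edge Lemma 3 in `w`, expanded over the patterns
  have hxT : x ∉ ({a₁, a₂} : Finset (Fin n)) := by
    simp only [Finset.mem_insert, Finset.mem_singleton, not_or]
    exact ⟨ha₁x.symm, ha₂x.symm⟩
  have hleT : ∀ a ∈ ({a₁, a₂} : Finset (Fin n)),
      (prodBernoulli w).real (openConn d b) ≤ (prodBernoulli w).real (openConn a b) := by
    intro a ha
    simp only [Finset.mem_insert, Finset.mem_singleton] at ha
    rcases ha with rfl | rfl
    exacts [hle₁, hle₂]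
  have hM := multiEdge_lemma3 w x d b {a₁, a₂} hxT hleT
  rw [al5_twoEdge_real_inter_R w x a₁ a₂ ha₂x h₁₂, al5_twoEdge_real_inter_R w x a₁ a₂ ha₂x h₁₂] at hM
  -- (b1), (b11): glue `e₁` at `a₁` (Lemma 5), then `e₂` at `x`
  set wA : Sym2 (Fin n) → unitInterval := fun e' => if e' = s(x, a₁) then 1 else w e' with hwA
  have hA : (prodBernoulli wA).real (openConn d b) ≤ (prodBernoulli wA).real (openConn x b) := by
    have key := al5_glue_edge w a₁ x d b ha₁x.symm hle₁
    have hfun : (fun e : Sym2 (Fin n) => if e ∈ ({s(a₁, x)} : Finset (Sym2 (Fin n))) then (1 : unitInterval)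
        else w e) = wA := by
      funext e
      simp only [Finset.mem_singleton, hwA, Sym2.eq_swap]
    rw [hfun] at key
    exact key.trans_eq (al5_real_openConn_eq_of_weight_one wA b (by simp only [hwA, if_true]) ha₁x)
  have hwA2 : wA s(x, a₂) = w s(x, a₂) := by simp only [hwA, hne.symm, if_false]
  have hwA1 : (fun e' : Sym2 (Fin n) => if e' = s(x, a₂) then (1 : unitInterval) else wA e') = w11 := by
    funext e; by_cases h1 : e = s(x, a₁)
    · subst h1; simp only [hwA, hw11, hne, if_false, if_true]
    · simp only [hwA, hw11, h1, if_false]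
  have hwA0 : (fun e' : Sym2 (Fin n) => if e' = s(x, a₂) then (0 : unitInterval) else wA e') = w10 := by
    funext e; by_cases h1 : e = s(x, a₁)
    · subst h1; simp only [hwA, hw10, hne, if_false, if_true]
    · simp only [hwA, hw10, h1, if_false]
  have hb1 := hA
  rw [al5_split_edge wA s(x, a₂) (openConn d b), al5_split_edge wA s(x, a₂) (openConn x b), hwA2, hwA1, hwA0]
    at hb1
  have hb11 : (prodBernoulli w11).real (openConn d b) ≤ (prodBernoulli w11).real (openConn x b) := by
    have key := al5_glue_edge wA x a₂ d b ha₂x hA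
    have hfun : (fun e : Sym2 (Fin n) => if e ∈ ({s(x, a₂)} : Finset (Sym2 (Fin n))) then (1 : unitInterval)
        else wA e) = w11 := by
      rw [← hwA1]
      funext e
      simp only [Finset.mem_singleton]
    rwa [hfun] at key
  -- (b2): glue `e₂` at `a₂`
  set wB : Sym2 (Fin n) → unitInterval := fun e' => if e' = s(x, a₂) then 1 else w e' with hwB
  have hB : (prodBernoulli wB).real (openConn d b) ≤ (prodBernoulli wB).real (openConn x b) := by
    have key := al5_glue_edge w a₂ x d b ha₂x.symm hle₂
    have hfun : (fun e : Sym2 (Fin n) => if e ∈ ({s(a₂, x)} : Finset (Sym2 (Fin n))) then (1 : unitInterval)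
        else w e) = wB := by
      funext e
      simp only [Finset.mem_singleton, hwB, Sym2.eq_swap]
    rw [hfun] at key
    exact key.trans_eq (al5_real_openConn_eq_of_weight_one wB b (by simp only [hwB, if_true]) ha₂x)
  have hwB1 : wB s(x, a₁) = w s(x, a₁) := by simp only [hwB, hne, if_false]
  have hwB1' : (fun e' : Sym2 (Fin n) => if e' = s(x, a₁) then (1 : unitInterval) else wB e') = w11 := by
    funext e; by_cases h1 : e = s(x, a₁)
    · subst h1; simp only [hwB, hw11, if_true]
    · by_cases h2 : e = s(x, a₂)
      · subst h2; simp only [hwB, hw11, hne.symm, if_false, if_true]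
      · simp only [hwB, hw11, h1, h2, if_false]
  have hwB0 : (fun e' : Sym2 (Fin n) => if e' = s(x, a₁) then (0 : unitInterval) else wB e') = w01 := by
    funext e; by_cases h1 : e = s(x, a₁)
    · subst h1; simp only [hwB, hw01, if_true]
    · by_cases h2 : e = s(x, a₂)
      · subst h2; simp only [hwB, hw01, hne.symm, if_false, if_true]
      · simp only [hwB, hw01, h1, h2, if_false]
  have hb2 := hB
  rw [al5_split_edge wB s(x, a₁) (openConn d b), al5_split_edge wB s(x, a₁) (openConn x b), hwB1, hwB1', hwB0]
    at hb2
  -- (T1): transfer along `t ↦ w[e₁ ↦ 1, e₂ ↦ t]`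
  have T1 : ∀ t : unitInterval,
      (t : ℝ) * (prodBernoulli w11).real (openConn d b) + (1 - (t : ℝ)) * (prodBernoulli w10).real (openConn d b) ≤
        (t : ℝ) * (prodBernoulli w11).real (openConn x b) + (1 - (t : ℝ)) * (prodBernoulli w10).real (openConn x b) →
      (t : ℝ) * (prodBernoulli g11).real (openConn d b) + (1 - (t : ℝ)) * (prodBernoulli g10).real (openConn d b) ≤
        (t : ℝ) * (prodBernoulli g11).real (openConn x b) + (1 - (t : ℝ)) * (prodBernoulli g10).real (openConn x b) := by
    intro t ht
    set wt : Sym2 (Fin n) → unitInterval :=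
      fun e => if e = s(x, a₁) then 1 else if e = s(x, a₂) then t else w e with hwt
    have hwt1 : wt s(x, a₁) = 1 := by simp only [hwt, if_true]
    have hwt2 : wt s(x, a₂) = t := by simp only [hwt, hne.symm, if_false, if_true]
    have hwt11 : (fun e' : Sym2 (Fin n) => if e' = s(x, a₂) then (1 : unitInterval) else wt e') = w11 := by
      funext e; by_cases h1 : e = s(x, a₁)
      · subst h1; simp only [hwt, hw11, hne, if_false, if_true]
      · by_cases h2 : e = s(x, a₂)
        · subst h2; simp only [hw11, hne.symm, if_false, if_true]
        · simp only [hwt, hw11, h1, h2, if_false]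
    have hwt10 : (fun e' : Sym2 (Fin n) => if e' = s(x, a₂) then (0 : unitInterval) else wt e') = w10 := by
      funext e; by_cases h1 : e = s(x, a₁)
      · subst h1; simp only [hwt, hw10, hne, if_false, if_true]
      · by_cases h2 : e = s(x, a₂)
        · subst h2; simp only [hw10, hne.symm, if_false, if_true]
        · simp only [hwt, hw10, h1, h2, if_false]
    -- the hypothesis `τ(d) ≤ τ(a₁)` holds for `wt`
    have hyp : (prodBernoulli wt).real (openConn d b) ≤ (prodBernoulli wt).real (openConn a₁ b) := by
      rw [al5_real_openConn_eq_of_weight_one wt b hwt1 ha₁x,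
        al5_split_edge wt s(x, a₂) (openConn d b), al5_split_edge wt s(x, a₂) (openConn x b), hwt2, hwt11, hwt10]
      exact ht
    -- single-layer AL5 for `wt`, expanded
    have L := al5_layer wt S x d b a₁ hS ha₁x hyp
    set gt : Sym2 (Fin n) → unitInterval := fun e => if e ∈ S.image (fun y => s(x, y)) then 1 else wt e with hgt
    change (prodBernoulli gt).real _ ≤ (prodBernoulli gt).real _ at L
    have hgt1 : gt s(x, a₁) = 1 := by simp only [hgt, himg a₁ ha₁S, if_false, hwt1]
    have hgt2 : gt s(x, a₂) = t := by simp only [hgt, himg a₂ ha₂S, if_false, hwt2]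
    have hgtS : ∀ e, e ≠ s(x, a₁) → e ≠ s(x, a₂) → gt e = gS e := by
      intro e h1 h2; simp only [hgt, hgS, hwt, h1, h2, if_false]
    rw [al5_twoEdge_real_inter_U1 gt x a₁ a₂ ha₂x h₁₂, al5_twoEdge_real_inter_U1 gt x a₁ a₂ ha₂x h₁₂,
      hpin gt gS hgtS 1 1, hpin gt gS hgtS 1 0, hgt1, hgt2] at L
    simp only [Set.Icc.coe_one, one_mul] at L
    exact L
  -- (T2): transfer along `t ↦ w[e₁ ↦ t, e₂ ↦ 1]`
  have T2 : ∀ t : unitInterval,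
      (t : ℝ) * (prodBernoulli w11).real (openConn d b) + (1 - (t : ℝ)) * (prodBernoulli w01).real (openConn d b) ≤
        (t : ℝ) * (prodBernoulli w11).real (openConn x b) + (1 - (t : ℝ)) * (prodBernoulli w01).real (openConn x b) →
      (t : ℝ) * (prodBernoulli g11).real (openConn d b) + (1 - (t : ℝ)) * (prodBernoulli g01).real (openConn d b) ≤
        (t : ℝ) * (prodBernoulli g11).real (openConn x b) + (1 - (t : ℝ)) * (prodBernoulli g01).real (openConn x b) := by
    intro t ht
    set wt : Sym2 (Fin n) → unitInterval :=
      fun e => if e = s(x, a₁) then t else if e = s(x, a₂) then 1 else w e with hwt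
    have hwt1 : wt s(x, a₁) = t := by simp only [hwt, if_true]
    have hwt2 : wt s(x, a₂) = 1 := by simp only [hwt, hne.symm, if_false, if_true]
    have hwt11 : (fun e' : Sym2 (Fin n) => if e' = s(x, a₁) then (1 : unitInterval) else wt e') = w11 := by
      funext e; by_cases h1 : e = s(x, a₁)
      · subst h1; simp only [hw11, if_true]
      · by_cases h2 : e = s(x, a₂)
        · subst h2; simp only [hwt, hw11, hne.symm, if_false, if_true]
        · simp only [hwt, hw11, h1, h2, if_false]
    have hwt01 : (fun e' : Sym2 (Fin n) => if e' = s(x, a₁) then (0 : unitInterval) else wt e') = w01 := by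
      funext e; by_cases h1 : e = s(x, a₁)
      · subst h1; simp only [hw01, if_true]
      · by_cases h2 : e = s(x, a₂)
        · subst h2; simp only [hwt, hw01, hne.symm, if_false, if_true]
        · simp only [hwt, hw01, h1, h2, if_false]
    have hyp : (prodBernoulli wt).real (openConn d b) ≤ (prodBernoulli wt).real (openConn a₂ b) := by
      rw [al5_real_openConn_eq_of_weight_one wt b hwt2 ha₂x,
        al5_split_edge wt s(x, a₁) (openConn d b), al5_split_edge wt s(x, a₁) (openConn x b), hwt1, hwt11, hwt01]
      exact ht
    have L := al5_layer wt S x d b a₂ hS ha₂x hyp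
    set gt : Sym2 (Fin n) → unitInterval := fun e => if e ∈ S.image (fun y => s(x, y)) then 1 else wt e with hgt
    change (prodBernoulli gt).real _ ≤ (prodBernoulli gt).real _ at L
    have hgt1 : gt s(x, a₁) = t := by simp only [hgt, himg a₁ ha₁S, if_false, hwt1]
    have hgt2 : gt s(x, a₂) = 1 := by simp only [hgt, himg a₂ ha₂S, if_false, hwt2]
    have hgtS : ∀ e, e ≠ s(x, a₁) → e ≠ s(x, a₂) → gt e = gS e := by
      intro e h1 h2; simp only [hgt, hgS, hwt, h1, h2, if_false]
    rw [al5_twoEdge_real_inter_U2 gt x a₁ a₂ ha₂x h₁₂, al5_twoEdge_real_inter_U2 gt x a₁ a₂ ha₂x h₁₂,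
      hpin gt gS hgtS 1 1, hpin gt gS hgtS 0 1, hgt1, hgt2] at L
    simp only [Set.Icc.coe_one, one_mul] at L
    exact L
  -- THE MARGIN, expanded over the patterns
  rw [al5_twoEdge_real_inter_R gS x a₁ a₂ ha₂x h₁₂, al5_twoEdge_real_inter_R gS x a₁ a₂ ha₂x h₁₂, hgS1, hgS2]
  -- bookkeeping
  set Xb11 := (prodBernoulli w11).real (openConn x b) with hXb11
  set Db11 := (prodBernoulli w11).real (openConn d b) with hDb11
  set Xb10 := (prodBernoulli w10).real (openConn x b) with hXb10
  set Db10 := (prodBernoulli w10).real (openConn d b) with hDb10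
  set Xb01 := (prodBernoulli w01).real (openConn x b) with hXb01
  set Db01 := (prodBernoulli w01).real (openConn d b) with hDb01
  set X11 := (prodBernoulli g11).real (openConn x b) with hX11
  set D11 := (prodBernoulli g11).real (openConn d b) with hD11
  set X10 := (prodBernoulli g10).real (openConn x b) with hX10
  set D10 := (prodBernoulli g10).real (openConn d b) with hD10
  set X01 := (prodBernoulli g01).real (openConn x b) with hX01
  set D01 := (prodBernoulli g01).real (openConn d b) with hD01
  have hp1 : 0 ≤ (w s(x, a₁) : ℝ) := unitInterval.nonneg _
  have hp1' : (w s(x, a₁) : ℝ) ≤ 1 := unitInterval.le_one _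
  have hp2 : 0 ≤ (w s(x, a₂) : ℝ) := unitInterval.nonneg _
  have hp2' : (w s(x, a₂) : ℝ) ≤ 1 := unitInterval.le_one _
  rw [← sub_nonneg]
  have key := al5_twoRelays_arith (gb11 := Xb11 - Db11) (gb10 := Xb10 - Db10) (gb01 := Xb01 - Db01)
    (g11 := X11 - D11) (g10 := X10 - D10) (g01 := X01 - D01) hp1 hp1' hp2 hp2'
    (by linarith) (by linarith) (by linarith) (sub_nonneg.2 hb11) ?_ ?_
  · linarith
  · intro t ht0 ht1 h
    have := T1 ⟨t, ht0, ht1⟩ (by dsimp only; linarith)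
    dsimp only at this
    linarith
  · intro t ht0 ht1 h
    have := T2 ⟨t, ht0, ht1⟩ (by dsimp only; linarith)
    dsimp only at this
    linarith

end AL5TwoRelaysGeneral

end

end Summit.CriticalPhenomena.PercolationContinuityZ3.Theorems
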